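import Mathlib
import HarnessLib
import Summits.Ventures.LatticeQCDFlow.Exactness.GaugeFTHMCCreutz
import Summits.Ventures.LatticeQCDFlow.Exactness.SU2WilsonFlowLOSchedule
import Summits.Ventures.LatticeQCDFlow.Exactness.NCPLayerEquiv

/-!
# `⟨e^{−ΔH}⟩ = 1` for FT-HMC through the SU(2) leading-order Wilson-flow member, and on the row's 4⁴ lattice

`GaugeFTHMCCreutz.lean` shows that the acceptance gate of row 14 (`⟨e^{−ΔH}⟩ = 1`) is an identity
of the exact field-transformed HMC kernel in equilibrium, for ANY certified layer `(F, J)`.  This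
file instantiates it on the `SU(2)` rung exactly as the engine runs it (momenta
`(Edge × Fin 3) → ℝ`, Gaussian kinetic term, the closed-form quaternion exponential drift of
`SU2WilsonFlowLOMember.measurable_su2Drift`, ANY measurable force, any trajectory length) and
through the engine's zero-parameter member:

* `integrable_exp_neg_of_le` — on a finite measure, `e^{−S}` is integrable for every measurable
  action bounded below (discharges the only size hypothesis for e.g. `β · S_W` on a compact group).
* `gauge_fthmc_leapfrog_gaussian_creutz_layers` — lists of certified layers compose
  (`hasJacobian_foldr_trans`, running log-det): Creutz's identity for `F = F_N ∘ ⋯ ∘ F_1`.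
* `su2_fthmc_leapfrog_gaussian_creutz` — the `SU(2)` rung, any certified `(F, J)`.
* `su2_fthmc_leapfrog_gaussian_creutz_wilsonFlowLO` — through ANY schedule of masked `SU(2)`
  Wilson-flow LO sub-steps (`exists_layers_su2WilsonFlowLO`; proper colouring, `2(d−1)|ε| < 1`).
* `su2_fthmc_acceptanceLattice_creutz` — **the row's acceptance configuration**: `d = L = 4`, the
  parity colouring (`exists_parityMask`), Lüscher's sweep schedule (`8 · nsweeps` sub-steps),
  `6|ε| < 1`: in equilibrium `⟨e^{−ΔH̃}⟩ = 1` EXACTLY, for every measurable action with `e^{−S}`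
  integrable against `⊗_e haarProbability SU(2)` (every action bounded below, by the first item).

NOT CLAIMED: the chain started out of equilibrium (burn-in), the `2σ` error model of the numerical
test (autocorrelations), floating point, any number; SU(N ≥ 3).

HONEST FRAMING: exact (Metropolis-corrected) sampling algorithms for lattice gauge theory; figures of
merit are autocorrelation/cost numbers at stated couplings and volumes; no continuum-physics claim.
-/

namespace Summit.Ventures.LatticeQCDFlow.Exactness

open Set Function MeasureTheory WithLp InnerProductGeometry
open Literature.Probability.MarkovChains.HMC (partitionFn boltzmann)
open Literature.MathematicalPhysics.QuantumFieldTheory Summit.Ventures.LatticeQCDFlow.Theory2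
open scoped ENNReal

/-! ## Discharging the size hypothesis -/

section Size

variable {Q : Type*} [MeasurableSpace Q]

/-- On a finite measure, `e^{−S}` is integrable for every measurable action bounded below
(`0 ≤ e^{−S v} ≤ e^{−m}`). -/
theorem integrable_exp_neg_of_le {μ : Measure Q} [IsFiniteMeasure μ] {S : Q → ℝ} (hS : Measurable S)
    {m : ℝ} (hm : ∀ v, m ≤ S v) : Integrable (fun v => Real.exp (-S v)) μ :=
  Integrable.of_mem_Icc 0 (Real.exp (-m)) (Real.measurable_exp.comp hS.neg).aemeasurable
    (ae_of_all _ fun v => ⟨(Real.exp_pos _).le, Real.exp_le_exp.2 (neg_le_neg (hm v))⟩)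

end Size

/-! ## Lists of certified layers -/

section Layers

variable {Q : Type*} [MeasurableSpace Q] {κ : Type*} [Fintype κ]

/-- **Creutz's identity through a composite of certified layers.**  For a list of layers
`(F_k, J_k)` (measurable equivalences with positive measurable certified Jacobians w.r.t. a
left-invariant probability measure `μ`), the composite `F = F_N ∘ ⋯ ∘ F_1` with the running
log-det `J` (as the engine books it) satisfies `⟨e^{−ΔH̃}⟩ = 1` in equilibrium — Gaussian momenta
`κ → ℝ`, any measurable drift and force, any trajectory length, `e^{−S}` integrable. -/
theorem gauge_fthmc_leapfrog_gaussian_creutz_layers [Group Q] [MeasurableMul₂ Q] {μ : Measure Q}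
    [μ.IsMulLeftInvariant] [IsProbabilityMeasure μ] (layers : List ((Q ≃ᵐ Q) × (Q → ℝ)))
    (hpos : ∀ Ly ∈ layers, ∀ v, 0 < Ly.2 v) (hmeas : ∀ Ly ∈ layers, Measurable Ly.2)
    (hjac : ∀ Ly ∈ layers, HasJacobian μ Ly.1 fun v => ENNReal.ofReal (Ly.2 v))
    {e : (κ → ℝ) → Q} (hem : Measurable e) {g : Q → (κ → ℝ)} (hg : Measurable g) (n : ℕ)
    {S : Q → ℝ} (hS : Measurable S) (hSi : Integrable (fun v => Real.exp (-S v)) μ) :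
    ∫ z, Real.exp (-(((S ((⇑(layers.foldr (fun Ly (G : Q ≃ᵐ Q) => Ly.1.trans G) (MeasurableEquiv.refl Q))) ((((flip : Equiv.Perm (Q × (κ → ℝ))) * leapfrog (mulDrift e) g ^ n)) z).1) -
            Real.log ((layers.foldr (fun Ly K => fun V => Ly.2 V * K (Ly.1 V)) (fun _ => (1 : ℝ))) ((((flip : Equiv.Perm (Q × (κ → ℝ))) * leapfrog (mulDrift e) g ^ n)) z).1)) +
            ∑ i, ((((flip : Equiv.Perm (Q × (κ → ℝ))) * leapfrog (mulDrift e) g ^ n)) z).2 i ^ 2 / 2) -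
          ((S ((⇑(layers.foldr (fun Ly (G : Q ≃ᵐ Q) => Ly.1.trans G) (MeasurableEquiv.refl Q))) z.1) - Real.log ((layers.foldr (fun Ly K => fun V => Ly.2 V * K (Ly.1 V)) (fun _ => (1 : ℝ))) z.1)) + ∑ i, z.2 i ^ 2 / 2)))
      ∂(boltzmann (μ.prod (volume : Measure (κ → ℝ)))
          fun z : Q × (κ → ℝ) => (S ((⇑(layers.foldr (fun Ly (G : Q ≃ᵐ Q) => Ly.1.trans G) (MeasurableEquiv.refl Q))) z.1) - Real.log ((layers.foldr (fun Ly K => fun V => Ly.2 V * K (Ly.1 V)) (fun _ => (1 : ℝ))) z.1)) + ∑ i, z.2 i ^ 2 / 2) = 1 := by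
  obtain ⟨h0, hm, hJ⟩ := hasJacobian_foldr_trans layers hpos hmeas hjac
  have h := gauge_fthmc_leapfrog_gaussian_creutz (μ := μ) (κ := κ)
    (F := (⇑(layers.foldr (fun Ly (G : Q ≃ᵐ Q) => Ly.1.trans G) (MeasurableEquiv.refl Q))))
    (J := (layers.foldr (fun Ly K => fun V => Ly.2 V * K (Ly.1 V)) (fun _ => (1 : ℝ))))
    (e := e) (g := g) (S := S) h0 hm hJ hem hg n hS hSi
  exact h

end Layers

/-! ## The SU(2) rung -/

section SU2

variable {d L : ℕ} {X : Type*} [DecidableEq X] (χ : Site d L → X) [NeZero L]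

omit [DecidableEq X] in
/-- **Creutz's identity for FT-HMC on the `SU(2)` rung as the engine runs it**: links
`GaugeConfig d L SU(2)` with product Haar probability, momenta `(Edge × Fin 3) → ℝ` Lebesgue with
`T = Σ p²/2`, the closed-form quaternion exponential drift, ANY measurable force `g`, any `n`, any
measurable action with `e^{−S}` integrable, ANY certified layer `(F, J)`:
`⟨e^{−ΔH̃}⟩ = 1` exactly in equilibrium. -/
theorem su2_fthmc_leapfrog_gaussian_creutz
    {F : GaugeConfig d L (Matrix.specialUnitaryGroup (Fin 2) ℂ) → GaugeConfig d L (Matrix.specialUnitaryGroup (Fin 2) ℂ)} {J : GaugeConfig d L (Matrix.specialUnitaryGroup (Fin 2) ℂ) → ℝ} (hJ : ∀ V, 0 < J V)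
    (hJm : Measurable J)
    (hF : HasJacobian (Measure.pi fun _ : Edge d L => haarProbability (Matrix.specialUnitaryGroup (Fin 2) ℂ)) F
      fun V => ENNReal.ofReal (J V))
    {S : GaugeConfig d L (Matrix.specialUnitaryGroup (Fin 2) ℂ) → ℝ} (hS : Measurable S)
    (hSi : Integrable (fun V => Real.exp (-S V))
      (Measure.pi fun _ : Edge d L => haarProbability (Matrix.specialUnitaryGroup (Fin 2) ℂ)))
    (c : ℝ) {g : GaugeConfig d L (Matrix.specialUnitaryGroup (Fin 2) ℂ) → ((Edge d L × Fin 3) → ℝ)} (hg : Measurable g) (n : ℕ) :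
    ∫ z, Real.exp (-(((S (F ((((flip : Equiv.Perm (GaugeConfig d L (Matrix.specialUnitaryGroup (Fin 2) ℂ) × ((Edge d L × Fin 3) → ℝ))) *
              leapfrog (mulDrift (fun p : ((Edge d L × Fin 3) → ℝ) => fun ℓ : Edge d L => gaussUnit (toLp 2
          ![Real.cos (c * Real.sqrt (p (ℓ, 0) ^ 2 + p (ℓ, 1) ^ 2 + p (ℓ, 2) ^ 2)),
            c * Real.sinc (c * Real.sqrt (p (ℓ, 0) ^ 2 + p (ℓ, 1) ^ 2 + p (ℓ, 2) ^ 2)) * p (ℓ, 0),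
            c * Real.sinc (c * Real.sqrt (p (ℓ, 0) ^ 2 + p (ℓ, 1) ^ 2 + p (ℓ, 2) ^ 2)) * p (ℓ, 1),
            c * Real.sinc (c * Real.sqrt (p (ℓ, 0) ^ 2 + p (ℓ, 1) ^ 2 + p (ℓ, 2) ^ 2)) * p (ℓ, 2)]))) g ^ n)) z).1) -
            Real.log (J ((((flip : Equiv.Perm (GaugeConfig d L (Matrix.specialUnitaryGroup (Fin 2) ℂ) × ((Edge d L × Fin 3) → ℝ))) *
              leapfrog (mulDrift (fun p : ((Edge d L × Fin 3) → ℝ) => fun ℓ : Edge d L => gaussUnit (toLp 2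
          ![Real.cos (c * Real.sqrt (p (ℓ, 0) ^ 2 + p (ℓ, 1) ^ 2 + p (ℓ, 2) ^ 2)),
            c * Real.sinc (c * Real.sqrt (p (ℓ, 0) ^ 2 + p (ℓ, 1) ^ 2 + p (ℓ, 2) ^ 2)) * p (ℓ, 0),
            c * Real.sinc (c * Real.sqrt (p (ℓ, 0) ^ 2 + p (ℓ, 1) ^ 2 + p (ℓ, 2) ^ 2)) * p (ℓ, 1),
            c * Real.sinc (c * Real.sqrt (p (ℓ, 0) ^ 2 + p (ℓ, 1) ^ 2 + p (ℓ, 2) ^ 2)) * p (ℓ, 2)]))) g ^ n)) z).1)) +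
            ∑ i, ((((flip : Equiv.Perm (GaugeConfig d L (Matrix.specialUnitaryGroup (Fin 2) ℂ) × ((Edge d L × Fin 3) → ℝ))) *
              leapfrog (mulDrift (fun p : ((Edge d L × Fin 3) → ℝ) => fun ℓ : Edge d L => gaussUnit (toLp 2
          ![Real.cos (c * Real.sqrt (p (ℓ, 0) ^ 2 + p (ℓ, 1) ^ 2 + p (ℓ, 2) ^ 2)),
            c * Real.sinc (c * Real.sqrt (p (ℓ, 0) ^ 2 + p (ℓ, 1) ^ 2 + p (ℓ, 2) ^ 2)) * p (ℓ, 0),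
            c * Real.sinc (c * Real.sqrt (p (ℓ, 0) ^ 2 + p (ℓ, 1) ^ 2 + p (ℓ, 2) ^ 2)) * p (ℓ, 1),
            c * Real.sinc (c * Real.sqrt (p (ℓ, 0) ^ 2 + p (ℓ, 1) ^ 2 + p (ℓ, 2) ^ 2)) * p (ℓ, 2)]))) g ^ n)) z).2 i ^ 2 / 2) -
          ((S (F z.1) - Real.log (J z.1)) + ∑ i, z.2 i ^ 2 / 2)))
      ∂(boltzmann ((Measure.pi fun _ : Edge d L => haarProbability (Matrix.specialUnitaryGroup (Fin 2) ℂ)).prod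
            (volume : Measure ((Edge d L × Fin 3) → ℝ)))
          fun z : GaugeConfig d L (Matrix.specialUnitaryGroup (Fin 2) ℂ) × ((Edge d L × Fin 3) → ℝ) =>
            (S (F z.1) - Real.log (J z.1)) + ∑ i, z.2 i ^ 2 / 2) = 1 :=
  gauge_fthmc_leapfrog_gaussian_creutz hJ hJm hF (measurable_su2Drift c) hg n hS hSi

/-- **Creutz's identity through the whole `SU(2)` leading-order Wilson-flow member** (any schedule
of masked sub-steps for a proper colouring `χ`, `2(d−1)|ε| < 1`, running log-det): the layers exist
with the engine's formulas (`exists_layers_su2WilsonFlowLO`) and `⟨e^{−ΔH̃}⟩ = 1` in equilibrium. -/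
theorem su2_fthmc_leapfrog_gaussian_creutz_wilsonFlowLO
    (hχ : ∀ (x : Site d L) (i : Fin d), χ (x.shift i) ≠ χ x) {ε : ℝ}
    (hε : |ε| * (2 * ((d - 1 : ℕ) : ℝ)) < 1) (sched : List (Fin d × X))
    {S : GaugeConfig d L (Matrix.specialUnitaryGroup (Fin 2) ℂ) → ℝ} (hS : Measurable S)
    (hSi : Integrable (fun V => Real.exp (-S V))
      (Measure.pi fun _ : Edge d L => haarProbability (Matrix.specialUnitaryGroup (Fin 2) ℂ)))
    (c : ℝ) {g : GaugeConfig d L (Matrix.specialUnitaryGroup (Fin 2) ℂ) → ((Edge d L × Fin 3) → ℝ)} (hg : Measurable g) (n : ℕ) :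
    ∃ layers : List ((GaugeConfig d L (Matrix.specialUnitaryGroup (Fin 2) ℂ) ≃ᵐ GaugeConfig d L (Matrix.specialUnitaryGroup (Fin 2) ℂ)) × (GaugeConfig d L (Matrix.specialUnitaryGroup (Fin 2) ℂ) → ℝ)),
      layers.map (fun Ly => ((Ly.1 : GaugeConfig d L (Matrix.specialUnitaryGroup (Fin 2) ℂ) → GaugeConfig d L (Matrix.specialUnitaryGroup (Fin 2) ℂ)), Ly.2)) =
        sched.map (fun s =>
        ((fun (V : GaugeConfig d L (Matrix.specialUnitaryGroup (Fin 2) ℂ)) (e : Edge d L) =>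
        if e.2 = s.1 ∧ χ e.1 = s.2 then
          gaussUnit (geodesicKick ε (∑ ν ∈ Finset.univ.erase e.2,
            (vecQuat (((V (Site.shift e.1 e.2, ν) * (V (Site.shift e.1 ν, e.2))⁻¹ * (V (e.1, ν))⁻¹)⁻¹ : (Matrix.specialUnitaryGroup (Fin 2) ℂ)) : Matrix (Fin 2) (Fin 2) ℂ) +
              vecQuat ((((V (Site.shift (e.1 - Pi.single ν 1) e.2, ν))⁻¹ * (V (e.1 - Pi.single ν 1, e.2))⁻¹ *
                V (e.1 - Pi.single ν 1, ν))⁻¹ : (Matrix.specialUnitaryGroup (Fin 2) ℂ)) : Matrix (Fin 2) (Fin 2) ℂ)))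
            (vecQuat ((V e : (Matrix.specialUnitaryGroup (Fin 2) ℂ)) : Matrix (Fin 2) (Fin 2) ℂ)))
        else V e),
         fun V : GaugeConfig d L (Matrix.specialUnitaryGroup (Fin 2) ℂ) => ∏ a : {e : Edge d L // e.2 = s.1 ∧ χ e.1 = s.2},
          (if Real.sin (angle (∑ ν ∈ Finset.univ.erase a.1.2,
            (vecQuat (((V (Site.shift a.1.1 a.1.2, ν) * (V (Site.shift a.1.1 ν, a.1.2))⁻¹ * (V (a.1.1, ν))⁻¹)⁻¹ : (Matrix.specialUnitaryGroup (Fin 2) ℂ)) : Matrix (Fin 2) (Fin 2) ℂ) +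
              vecQuat ((((V (Site.shift (a.1.1 - Pi.single ν 1) a.1.2, ν))⁻¹ * (V (a.1.1 - Pi.single ν 1, a.1.2))⁻¹ *
                V (a.1.1 - Pi.single ν 1, ν))⁻¹ : (Matrix.specialUnitaryGroup (Fin 2) ℂ)) : Matrix (Fin 2) (Fin 2) ℂ))) (vecQuat ((V a.1 : (Matrix.specialUnitaryGroup (Fin 2) ℂ)) : Matrix (Fin 2) (Fin 2) ℂ))) = 0 then
            (1 - ε * ‖(∑ ν ∈ Finset.univ.erase a.1.2,
            (vecQuat (((V (Site.shift a.1.1 a.1.2, ν) * (V (Site.shift a.1.1 ν, a.1.2))⁻¹ * (V (a.1.1, ν))⁻¹)⁻¹ : (Matrix.specialUnitaryGroup (Fin 2) ℂ)) : Matrix (Fin 2) (Fin 2) ℂ) +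
              vecQuat ((((V (Site.shift (a.1.1 - Pi.single ν 1) a.1.2, ν))⁻¹ * (V (a.1.1 - Pi.single ν 1, a.1.2))⁻¹ *
                V (a.1.1 - Pi.single ν 1, ν))⁻¹ : (Matrix.specialUnitaryGroup (Fin 2) ℂ)) : Matrix (Fin 2) (Fin 2) ℂ)))‖ * Real.cos (angle (∑ ν ∈ Finset.univ.erase a.1.2,
            (vecQuat (((V (Site.shift a.1.1 a.1.2, ν) * (V (Site.shift a.1.1 ν, a.1.2))⁻¹ * (V (a.1.1, ν))⁻¹)⁻¹ : (Matrix.specialUnitaryGroup (Fin 2) ℂ)) : Matrix (Fin 2) (Fin 2) ℂ) +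
              vecQuat ((((V (Site.shift (a.1.1 - Pi.single ν 1) a.1.2, ν))⁻¹ * (V (a.1.1 - Pi.single ν 1, a.1.2))⁻¹ *
                V (a.1.1 - Pi.single ν 1, ν))⁻¹ : (Matrix.specialUnitaryGroup (Fin 2) ℂ)) : Matrix (Fin 2) (Fin 2) ℂ))) (vecQuat ((V a.1 : (Matrix.specialUnitaryGroup (Fin 2) ℂ)) : Matrix (Fin 2) (Fin 2) ℂ)))) ^ 3
          else kickJac (ε * ‖(∑ ν ∈ Finset.univ.erase a.1.2,
            (vecQuat (((V (Site.shift a.1.1 a.1.2, ν) * (V (Site.shift a.1.1 ν, a.1.2))⁻¹ * (V (a.1.1, ν))⁻¹)⁻¹ : (Matrix.specialUnitaryGroup (Fin 2) ℂ)) : Matrix (Fin 2) (Fin 2) ℂ) +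
              vecQuat ((((V (Site.shift (a.1.1 - Pi.single ν 1) a.1.2, ν))⁻¹ * (V (a.1.1 - Pi.single ν 1, a.1.2))⁻¹ *
                V (a.1.1 - Pi.single ν 1, ν))⁻¹ : (Matrix.specialUnitaryGroup (Fin 2) ℂ)) : Matrix (Fin 2) (Fin 2) ℂ)))‖) 2 (angle (∑ ν ∈ Finset.univ.erase a.1.2,
            (vecQuat (((V (Site.shift a.1.1 a.1.2, ν) * (V (Site.shift a.1.1 ν, a.1.2))⁻¹ * (V (a.1.1, ν))⁻¹)⁻¹ : (Matrix.specialUnitaryGroup (Fin 2) ℂ)) : Matrix (Fin 2) (Fin 2) ℂ) +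
              vecQuat ((((V (Site.shift (a.1.1 - Pi.single ν 1) a.1.2, ν))⁻¹ * (V (a.1.1 - Pi.single ν 1, a.1.2))⁻¹ *
                V (a.1.1 - Pi.single ν 1, ν))⁻¹ : (Matrix.specialUnitaryGroup (Fin 2) ℂ)) : Matrix (Fin 2) (Fin 2) ℂ))) (vecQuat ((V a.1 : (Matrix.specialUnitaryGroup (Fin 2) ℂ)) : Matrix (Fin 2) (Fin 2) ℂ)))))) ∧
      ∫ z, Real.exp (-(((S ((⇑(layers.foldr (fun Ly (G : GaugeConfig d L (Matrix.specialUnitaryGroup (Fin 2) ℂ) ≃ᵐ GaugeConfig d L (Matrix.specialUnitaryGroup (Fin 2) ℂ)) => Ly.1.trans G)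
              (MeasurableEquiv.refl (GaugeConfig d L (Matrix.specialUnitaryGroup (Fin 2) ℂ))))) ((((flip : Equiv.Perm (GaugeConfig d L (Matrix.specialUnitaryGroup (Fin 2) ℂ) × ((Edge d L × Fin 3) → ℝ))) *
              leapfrog (mulDrift (fun p : ((Edge d L × Fin 3) → ℝ) => fun ℓ : Edge d L => gaussUnit (toLp 2
          ![Real.cos (c * Real.sqrt (p (ℓ, 0) ^ 2 + p (ℓ, 1) ^ 2 + p (ℓ, 2) ^ 2)),
            c * Real.sinc (c * Real.sqrt (p (ℓ, 0) ^ 2 + p (ℓ, 1) ^ 2 + p (ℓ, 2) ^ 2)) * p (ℓ, 0),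
            c * Real.sinc (c * Real.sqrt (p (ℓ, 0) ^ 2 + p (ℓ, 1) ^ 2 + p (ℓ, 2) ^ 2)) * p (ℓ, 1),
            c * Real.sinc (c * Real.sqrt (p (ℓ, 0) ^ 2 + p (ℓ, 1) ^ 2 + p (ℓ, 2) ^ 2)) * p (ℓ, 2)]))) g ^ n)) z).1) -
            Real.log ((layers.foldr (fun Ly K => fun V => Ly.2 V * K (Ly.1 V)) (fun _ => (1 : ℝ))) ((((flip : Equiv.Perm (GaugeConfig d L (Matrix.specialUnitaryGroup (Fin 2) ℂ) × ((Edge d L × Fin 3) → ℝ))) *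
              leapfrog (mulDrift (fun p : ((Edge d L × Fin 3) → ℝ) => fun ℓ : Edge d L => gaussUnit (toLp 2
          ![Real.cos (c * Real.sqrt (p (ℓ, 0) ^ 2 + p (ℓ, 1) ^ 2 + p (ℓ, 2) ^ 2)),
            c * Real.sinc (c * Real.sqrt (p (ℓ, 0) ^ 2 + p (ℓ, 1) ^ 2 + p (ℓ, 2) ^ 2)) * p (ℓ, 0),
            c * Real.sinc (c * Real.sqrt (p (ℓ, 0) ^ 2 + p (ℓ, 1) ^ 2 + p (ℓ, 2) ^ 2)) * p (ℓ, 1),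
            c * Real.sinc (c * Real.sqrt (p (ℓ, 0) ^ 2 + p (ℓ, 1) ^ 2 + p (ℓ, 2) ^ 2)) * p (ℓ, 2)]))) g ^ n)) z).1)) +
            ∑ i, ((((flip : Equiv.Perm (GaugeConfig d L (Matrix.specialUnitaryGroup (Fin 2) ℂ) × ((Edge d L × Fin 3) → ℝ))) *
              leapfrog (mulDrift (fun p : ((Edge d L × Fin 3) → ℝ) => fun ℓ : Edge d L => gaussUnit (toLp 2
          ![Real.cos (c * Real.sqrt (p (ℓ, 0) ^ 2 + p (ℓ, 1) ^ 2 + p (ℓ, 2) ^ 2)),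
            c * Real.sinc (c * Real.sqrt (p (ℓ, 0) ^ 2 + p (ℓ, 1) ^ 2 + p (ℓ, 2) ^ 2)) * p (ℓ, 0),
            c * Real.sinc (c * Real.sqrt (p (ℓ, 0) ^ 2 + p (ℓ, 1) ^ 2 + p (ℓ, 2) ^ 2)) * p (ℓ, 1),
            c * Real.sinc (c * Real.sqrt (p (ℓ, 0) ^ 2 + p (ℓ, 1) ^ 2 + p (ℓ, 2) ^ 2)) * p (ℓ, 2)]))) g ^ n)) z).2 i ^ 2 / 2) -
          ((S ((⇑(layers.foldr (fun Ly (G : GaugeConfig d L (Matrix.specialUnitaryGroup (Fin 2) ℂ) ≃ᵐ GaugeConfig d L (Matrix.specialUnitaryGroup (Fin 2) ℂ)) => Ly.1.trans G)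
              (MeasurableEquiv.refl (GaugeConfig d L (Matrix.specialUnitaryGroup (Fin 2) ℂ))))) z.1) - Real.log ((layers.foldr (fun Ly K => fun V => Ly.2 V * K (Ly.1 V)) (fun _ => (1 : ℝ))) z.1)) + ∑ i, z.2 i ^ 2 / 2)))
      ∂(boltzmann ((Measure.pi fun _ : Edge d L => haarProbability (Matrix.specialUnitaryGroup (Fin 2) ℂ)).prod
            (volume : Measure ((Edge d L × Fin 3) → ℝ)))
          fun z : GaugeConfig d L (Matrix.specialUnitaryGroup (Fin 2) ℂ) × ((Edge d L × Fin 3) → ℝ) =>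
            (S ((⇑(layers.foldr (fun Ly (G : GaugeConfig d L (Matrix.specialUnitaryGroup (Fin 2) ℂ) ≃ᵐ GaugeConfig d L (Matrix.specialUnitaryGroup (Fin 2) ℂ)) => Ly.1.trans G)
              (MeasurableEquiv.refl (GaugeConfig d L (Matrix.specialUnitaryGroup (Fin 2) ℂ))))) z.1) - Real.log ((layers.foldr (fun Ly K => fun V => Ly.2 V * K (Ly.1 V)) (fun _ => (1 : ℝ))) z.1)) + ∑ i, z.2 i ^ 2 / 2) = 1 := by
  obtain ⟨layers, hmap, hpos, hmeas, hjac⟩ := exists_layers_su2WilsonFlowLO χ hχ hε sched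
  exact ⟨layers, hmap, gauge_fthmc_leapfrog_gaussian_creutz_layers layers hpos hmeas hjac
    (measurable_su2Drift c) hg n hS hSi⟩

end SU2

/-! ## The row's acceptance configuration: 4⁴, parity masks, Lüscher's schedule -/

section Acceptance

/-- **`⟨e^{−ΔH}⟩ = 1` on the acceptance lattice.**  `d = L = 4`, `SU(2)` links with product Haar
probability; the parity colouring exists (`L = 4` is even), the sweep schedule (4 directions × 2
parities, `nsweeps` times) gives `8 · nsweeps` certified sub-steps under `6|ε| < 1`; for every
measurable action with `e^{−S}` integrable (every action bounded below — `integrable_exp_neg_of_le`),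
every force, every trajectory length: FT-HMC through the engine's LO Wilson-flow member, started in
equilibrium, has `𝔼[e^{−ΔH̃}] = 1` EXACTLY — the quantity row 14's numerical gate estimates. -/
theorem su2_fthmc_acceptanceLattice_creutz {ε : ℝ} (hε : |ε| * 6 < 1) (nsweeps : ℕ)
    {S : GaugeConfig 4 4 (Matrix.specialUnitaryGroup (Fin 2) ℂ) → ℝ} (hS : Measurable S)
    (hSi : Integrable (fun V => Real.exp (-S V))
      (Measure.pi fun _ : Edge 4 4 => haarProbability (Matrix.specialUnitaryGroup (Fin 2) ℂ)))
    (c : ℝ) {g : GaugeConfig 4 4 (Matrix.specialUnitaryGroup (Fin 2) ℂ) → ((Edge 4 4 × Fin 3) → ℝ)} (hg : Measurable g) (n : ℕ) :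
    ∃ χ : Site 4 4 → ZMod 2, (∀ (x : Site 4 4) (i : Fin 4), χ (x.shift i) ≠ χ x) ∧
    ∃ layers : List ((GaugeConfig 4 4 (Matrix.specialUnitaryGroup (Fin 2) ℂ) ≃ᵐ GaugeConfig 4 4 (Matrix.specialUnitaryGroup (Fin 2) ℂ)) × (GaugeConfig 4 4 (Matrix.specialUnitaryGroup (Fin 2) ℂ) → ℝ)),
      layers.map (fun Ly => ((Ly.1 : GaugeConfig 4 4 (Matrix.specialUnitaryGroup (Fin 2) ℂ) → GaugeConfig 4 4 (Matrix.specialUnitaryGroup (Fin 2) ℂ)), Ly.2)) =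
        ((List.replicate nsweeps ((List.finRange 4).flatMap fun μ : Fin 4 => [(μ, (0 : ZMod 2)), (μ, 1)])).flatten).map (fun s =>
        ((fun (V : GaugeConfig 4 4 (Matrix.specialUnitaryGroup (Fin 2) ℂ)) (e : Edge 4 4) =>
        if e.2 = s.1 ∧ χ e.1 = s.2 then
          gaussUnit (geodesicKick ε (∑ ν ∈ Finset.univ.erase e.2,
            (vecQuat (((V (Site.shift e.1 e.2, ν) * (V (Site.shift e.1 ν, e.2))⁻¹ * (V (e.1, ν))⁻¹)⁻¹ : (Matrix.specialUnitaryGroup (Fin 2) ℂ)) : Matrix (Fin 2) (Fin 2) ℂ) +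
              vecQuat ((((V (Site.shift (e.1 - Pi.single ν 1) e.2, ν))⁻¹ * (V (e.1 - Pi.single ν 1, e.2))⁻¹ *
                V (e.1 - Pi.single ν 1, ν))⁻¹ : (Matrix.specialUnitaryGroup (Fin 2) ℂ)) : Matrix (Fin 2) (Fin 2) ℂ)))
            (vecQuat ((V e : (Matrix.specialUnitaryGroup (Fin 2) ℂ)) : Matrix (Fin 2) (Fin 2) ℂ)))
        else V e),
         fun V : GaugeConfig 4 4 (Matrix.specialUnitaryGroup (Fin 2) ℂ) => ∏ a : {e : Edge 4 4 // e.2 = s.1 ∧ χ e.1 = s.2},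
          (if Real.sin (angle (∑ ν ∈ Finset.univ.erase a.1.2,
            (vecQuat (((V (Site.shift a.1.1 a.1.2, ν) * (V (Site.shift a.1.1 ν, a.1.2))⁻¹ * (V (a.1.1, ν))⁻¹)⁻¹ : (Matrix.specialUnitaryGroup (Fin 2) ℂ)) : Matrix (Fin 2) (Fin 2) ℂ) +
              vecQuat ((((V (Site.shift (a.1.1 - Pi.single ν 1) a.1.2, ν))⁻¹ * (V (a.1.1 - Pi.single ν 1, a.1.2))⁻¹ *
                V (a.1.1 - Pi.single ν 1, ν))⁻¹ : (Matrix.specialUnitaryGroup (Fin 2) ℂ)) : Matrix (Fin 2) (Fin 2) ℂ))) (vecQuat ((V a.1 : (Matrix.specialUnitaryGroup (Fin 2) ℂ)) : Matrix (Fin 2) (Fin 2) ℂ))) = 0 then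
            (1 - ε * ‖(∑ ν ∈ Finset.univ.erase a.1.2,
            (vecQuat (((V (Site.shift a.1.1 a.1.2, ν) * (V (Site.shift a.1.1 ν, a.1.2))⁻¹ * (V (a.1.1, ν))⁻¹)⁻¹ : (Matrix.specialUnitaryGroup (Fin 2) ℂ)) : Matrix (Fin 2) (Fin 2) ℂ) +
              vecQuat ((((V (Site.shift (a.1.1 - Pi.single ν 1) a.1.2, ν))⁻¹ * (V (a.1.1 - Pi.single ν 1, a.1.2))⁻¹ *
                V (a.1.1 - Pi.single ν 1, ν))⁻¹ : (Matrix.specialUnitaryGroup (Fin 2) ℂ)) : Matrix (Fin 2) (Fin 2) ℂ)))‖ * Real.cos (angle (∑ ν ∈ Finset.univ.erase a.1.2,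
            (vecQuat (((V (Site.shift a.1.1 a.1.2, ν) * (V (Site.shift a.1.1 ν, a.1.2))⁻¹ * (V (a.1.1, ν))⁻¹)⁻¹ : (Matrix.specialUnitaryGroup (Fin 2) ℂ)) : Matrix (Fin 2) (Fin 2) ℂ) +
              vecQuat ((((V (Site.shift (a.1.1 - Pi.single ν 1) a.1.2, ν))⁻¹ * (V (a.1.1 - Pi.single ν 1, a.1.2))⁻¹ *
                V (a.1.1 - Pi.single ν 1, ν))⁻¹ : (Matrix.specialUnitaryGroup (Fin 2) ℂ)) : Matrix (Fin 2) (Fin 2) ℂ))) (vecQuat ((V a.1 : (Matrix.specialUnitaryGroup (Fin 2) ℂ)) : Matrix (Fin 2) (Fin 2) ℂ)))) ^ 3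
          else kickJac (ε * ‖(∑ ν ∈ Finset.univ.erase a.1.2,
            (vecQuat (((V (Site.shift a.1.1 a.1.2, ν) * (V (Site.shift a.1.1 ν, a.1.2))⁻¹ * (V (a.1.1, ν))⁻¹)⁻¹ : (Matrix.specialUnitaryGroup (Fin 2) ℂ)) : Matrix (Fin 2) (Fin 2) ℂ) +
              vecQuat ((((V (Site.shift (a.1.1 - Pi.single ν 1) a.1.2, ν))⁻¹ * (V (a.1.1 - Pi.single ν 1, a.1.2))⁻¹ *
                V (a.1.1 - Pi.single ν 1, ν))⁻¹ : (Matrix.specialUnitaryGroup (Fin 2) ℂ)) : Matrix (Fin 2) (Fin 2) ℂ)))‖) 2 (angle (∑ ν ∈ Finset.univ.erase a.1.2,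
            (vecQuat (((V (Site.shift a.1.1 a.1.2, ν) * (V (Site.shift a.1.1 ν, a.1.2))⁻¹ * (V (a.1.1, ν))⁻¹)⁻¹ : (Matrix.specialUnitaryGroup (Fin 2) ℂ)) : Matrix (Fin 2) (Fin 2) ℂ) +
              vecQuat ((((V (Site.shift (a.1.1 - Pi.single ν 1) a.1.2, ν))⁻¹ * (V (a.1.1 - Pi.single ν 1, a.1.2))⁻¹ *
                V (a.1.1 - Pi.single ν 1, ν))⁻¹ : (Matrix.specialUnitaryGroup (Fin 2) ℂ)) : Matrix (Fin 2) (Fin 2) ℂ))) (vecQuat ((V a.1 : (Matrix.specialUnitaryGroup (Fin 2) ℂ)) : Matrix (Fin 2) (Fin 2) ℂ)))))) ∧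
      layers.length = 8 * nsweeps ∧
      ∫ z, Real.exp (-(((S ((⇑(layers.foldr (fun Ly (G : GaugeConfig 4 4 (Matrix.specialUnitaryGroup (Fin 2) ℂ) ≃ᵐ GaugeConfig 4 4 (Matrix.specialUnitaryGroup (Fin 2) ℂ)) => Ly.1.trans G)
              (MeasurableEquiv.refl (GaugeConfig 4 4 (Matrix.specialUnitaryGroup (Fin 2) ℂ))))) ((((flip : Equiv.Perm (GaugeConfig 4 4 (Matrix.specialUnitaryGroup (Fin 2) ℂ) × ((Edge 4 4 × Fin 3) → ℝ))) *
              leapfrog (mulDrift (fun p : ((Edge 4 4 × Fin 3) → ℝ) => fun ℓ : Edge 4 4 => gaussUnit (toLp 2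
          ![Real.cos (c * Real.sqrt (p (ℓ, 0) ^ 2 + p (ℓ, 1) ^ 2 + p (ℓ, 2) ^ 2)),
            c * Real.sinc (c * Real.sqrt (p (ℓ, 0) ^ 2 + p (ℓ, 1) ^ 2 + p (ℓ, 2) ^ 2)) * p (ℓ, 0),
            c * Real.sinc (c * Real.sqrt (p (ℓ, 0) ^ 2 + p (ℓ, 1) ^ 2 + p (ℓ, 2) ^ 2)) * p (ℓ, 1),
            c * Real.sinc (c * Real.sqrt (p (ℓ, 0) ^ 2 + p (ℓ, 1) ^ 2 + p (ℓ, 2) ^ 2)) * p (ℓ, 2)]))) g ^ n)) z).1) -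
            Real.log ((layers.foldr (fun Ly K => fun V => Ly.2 V * K (Ly.1 V)) (fun _ => (1 : ℝ))) ((((flip : Equiv.Perm (GaugeConfig 4 4 (Matrix.specialUnitaryGroup (Fin 2) ℂ) × ((Edge 4 4 × Fin 3) → ℝ))) *
              leapfrog (mulDrift (fun p : ((Edge 4 4 × Fin 3) → ℝ) => fun ℓ : Edge 4 4 => gaussUnit (toLp 2
          ![Real.cos (c * Real.sqrt (p (ℓ, 0) ^ 2 + p (ℓ, 1) ^ 2 + p (ℓ, 2) ^ 2)),
            c * Real.sinc (c * Real.sqrt (p (ℓ, 0) ^ 2 + p (ℓ, 1) ^ 2 + p (ℓ, 2) ^ 2)) * p (ℓ, 0),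
            c * Real.sinc (c * Real.sqrt (p (ℓ, 0) ^ 2 + p (ℓ, 1) ^ 2 + p (ℓ, 2) ^ 2)) * p (ℓ, 1),
            c * Real.sinc (c * Real.sqrt (p (ℓ, 0) ^ 2 + p (ℓ, 1) ^ 2 + p (ℓ, 2) ^ 2)) * p (ℓ, 2)]))) g ^ n)) z).1)) +
            ∑ i, ((((flip : Equiv.Perm (GaugeConfig 4 4 (Matrix.specialUnitaryGroup (Fin 2) ℂ) × ((Edge 4 4 × Fin 3) → ℝ))) *
              leapfrog (mulDrift (fun p : ((Edge 4 4 × Fin 3) → ℝ) => fun ℓ : Edge 4 4 => gaussUnit (toLp 2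
          ![Real.cos (c * Real.sqrt (p (ℓ, 0) ^ 2 + p (ℓ, 1) ^ 2 + p (ℓ, 2) ^ 2)),
            c * Real.sinc (c * Real.sqrt (p (ℓ, 0) ^ 2 + p (ℓ, 1) ^ 2 + p (ℓ, 2) ^ 2)) * p (ℓ, 0),
            c * Real.sinc (c * Real.sqrt (p (ℓ, 0) ^ 2 + p (ℓ, 1) ^ 2 + p (ℓ, 2) ^ 2)) * p (ℓ, 1),
            c * Real.sinc (c * Real.sqrt (p (ℓ, 0) ^ 2 + p (ℓ, 1) ^ 2 + p (ℓ, 2) ^ 2)) * p (ℓ, 2)]))) g ^ n)) z).2 i ^ 2 / 2) -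
          ((S ((⇑(layers.foldr (fun Ly (G : GaugeConfig 4 4 (Matrix.specialUnitaryGroup (Fin 2) ℂ) ≃ᵐ GaugeConfig 4 4 (Matrix.specialUnitaryGroup (Fin 2) ℂ)) => Ly.1.trans G)
              (MeasurableEquiv.refl (GaugeConfig 4 4 (Matrix.specialUnitaryGroup (Fin 2) ℂ))))) z.1) - Real.log ((layers.foldr (fun Ly K => fun V => Ly.2 V * K (Ly.1 V)) (fun _ => (1 : ℝ))) z.1)) + ∑ i, z.2 i ^ 2 / 2)))
      ∂(boltzmann ((Measure.pi fun _ : Edge 4 4 => haarProbability (Matrix.specialUnitaryGroup (Fin 2) ℂ)).prod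
            (volume : Measure ((Edge 4 4 × Fin 3) → ℝ)))
          fun z : GaugeConfig 4 4 (Matrix.specialUnitaryGroup (Fin 2) ℂ) × ((Edge 4 4 × Fin 3) → ℝ) =>
            (S ((⇑(layers.foldr (fun Ly (G : GaugeConfig 4 4 (Matrix.specialUnitaryGroup (Fin 2) ℂ) ≃ᵐ GaugeConfig 4 4 (Matrix.specialUnitaryGroup (Fin 2) ℂ)) => Ly.1.trans G)
              (MeasurableEquiv.refl (GaugeConfig 4 4 (Matrix.specialUnitaryGroup (Fin 2) ℂ))))) z.1) - Real.log ((layers.foldr (fun Ly K => fun V => Ly.2 V * K (Ly.1 V)) (fun _ => (1 : ℝ))) z.1)) + ∑ i, z.2 i ^ 2 / 2) = 1 := by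
  obtain ⟨χ, hχ⟩ := exists_parityMask (d := 4) (L := 4) (by decide)
  have hε' : |ε| * (2 * ((4 - 1 : ℕ) : ℝ)) < 1 := by norm_num; linarith
  obtain ⟨layers, hmap, hcr⟩ := su2_fthmc_leapfrog_gaussian_creutz_wilsonFlowLO χ hχ hε'
    ((List.replicate nsweeps ((List.finRange 4).flatMap fun μ : Fin 4 => [(μ, (0 : ZMod 2)), (μ, 1)])).flatten) hS hSi c hg n
  refine ⟨χ, hχ, layers, hmap, ?_, hcr⟩
  have h := congrArg List.length hmap
  rw [List.length_map, List.length_map] at h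
  rw [h]
  simp [List.length_flatten, List.length_flatMap, mul_comm]

end Acceptance

end Summit.Ventures.LatticeQCDFlow.Exactness
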